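import Summits.Ventures.PercRepro.RankLevelSetDenseCount
import Summits.Ventures.PercRepro.TheoremCLimit
import Summits.Ventures.PercRepro.MatroidMidCount

/-!
# PercRepro — THEOREM C (kernel form): C-025 for simple matroids of bounded corank and large rank (night-1, gen 0)

`proofs/NIGHT-1-C025-induction.md` §10. For every `q ≥ 2` and every corank `d ≥ q + 1` there is `N₀` such that every
SIMPLE finite matroid (all circuits have `≥ 3` elements) of rank `p`, with `|E| = p + d ≥ N₀` and `q + 2 ≤ p`, satisfies
the `C025` body `Φ(p,q)·#U(p,q) ≤ #Y(p,q)`. The ingredients: Proposition C₀ (Y) (`ncard_eRk_le_le`, `ncard_spanning_le`),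
Proposition C₀ (U) (`ncard_eRk_eq_le`, `ncard_circuitsLE_le`), the bound `Φ ≤ 2^{p+q}/C(p+q,p)` (`phiK_le_two_pow_div`),
the binomial estimates `n^q/q! ≥ C(n,q)`, `C(m,q) ≥ (m+1−q)^q/q!`, and the limit `seqF → 2^q/2^d < 1` (`exists_bound_seqF`).
The reductions to the simple rank-`p` case (truncation, loops, parallel pairs + induction on `q`) are on paper in §10.
Axioms: standard.
-/

namespace PercRepro

open Finset Set

variable {α : Type*}

/-- The number of subsets of a finset, as a set of sets: `2^{|E|}`. -/
theorem ncard_subsets_eq (E : Finset α) : {X : Set α | X ⊆ (E : Set α)}.ncard = 2 ^ E.card := by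
  classical
  have himg : {X : Set α | X ⊆ (E : Set α)} = (fun s : Finset α => (s : Set α)) '' ((E.powerset : Finset (Finset α)) : Set (Finset α)) := by
    ext X
    simp only [Set.mem_setOf_eq, Set.mem_image, Finset.mem_coe, Finset.mem_powerset]
    constructor
    · intro hXE
      have hXfin : X.Finite := E.finite_toSet.subset hXE
      refine ⟨hXfin.toFinset, ?_, by simp⟩
      intro x hx
      exact Finset.mem_coe.1 (hXE ((Set.Finite.mem_toFinset hXfin).1 hx))
    · rintro ⟨s, hsE, rfl⟩
      exact Finset.coe_subset.2 hsE
  rw [himg, Set.ncard_image_of_injective _ Finset.coe_injective, Set.ncard_coe_finset, Finset.card_powerset]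

namespace Matroid

variable {α : Type*} {M : _root_.Matroid α} [M.Finite]

/-- **`2^n ≤ #Y(p,q) + #{r ≤ q} + #{spanning}`** for a matroid of rank `p`: every subset of `E` has rank `≤ q`, in
`(q, p)`, or `= p`. -/
theorem two_pow_le_midCount_add (p q : ℕ) (hR : M.eRank = (p : ℕ∞)) :
    2 ^ M.ground_finite.toFinset.card ≤ midCount M p q + {X : Set α | X ⊆ M.E ∧ M.eRk X ≤ q}.ncard +
      {X : Set α | X ⊆ M.E ∧ M.eRk X = M.eRank}.ncard := by
  have hE : (M.ground_finite.toFinset : Set α) = M.E := Set.Finite.coe_toFinset _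
  have hsub : {X : Set α | X ⊆ (M.ground_finite.toFinset : Set α)} ⊆
      ({A : Set α | A ⊆ M.E ∧ (q : ℕ∞) < M.eRk A ∧ M.eRk A < (p : ℕ∞)} ∪
        {X : Set α | X ⊆ M.E ∧ M.eRk X ≤ q}) ∪ {X : Set α | X ⊆ M.E ∧ M.eRk X = M.eRank} := by
    intro X hX
    rw [hE] at hX
    by_cases h1 : M.eRk X ≤ q
    · exact Or.inl (Or.inr ⟨hX, h1⟩)
    · by_cases h2 : M.eRk X < p
      · exact Or.inl (Or.inl ⟨hX, not_le.1 h1, h2⟩)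
      · refine Or.inr ⟨hX, le_antisymm (M.eRk_le_eRank X) ?_⟩
        rw [hR]; exact not_lt.1 h2
  have hfin : ∀ P : Set α → Prop, {X : Set α | X ⊆ M.E ∧ P X}.Finite :=
    fun P => M.ground_finite.finite_subsets.subset (fun X hX => hX.1)
  calc 2 ^ M.ground_finite.toFinset.card = {X : Set α | X ⊆ (M.ground_finite.toFinset : Set α)}.ncard :=
        (ncard_subsets_eq _).symm
    _ ≤ (({A : Set α | A ⊆ M.E ∧ (q : ℕ∞) < M.eRk A ∧ M.eRk A < (p : ℕ∞)} ∪
          {X : Set α | X ⊆ M.E ∧ M.eRk X ≤ q}) ∪ {X : Set α | X ⊆ M.E ∧ M.eRk X = M.eRank}).ncard :=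
        Set.ncard_le_ncard hsub (((hfin _).union (hfin _)).union (hfin _))
    _ ≤ ({A : Set α | A ⊆ M.E ∧ (q : ℕ∞) < M.eRk A ∧ M.eRk A < (p : ℕ∞)} ∪
          {X : Set α | X ⊆ M.E ∧ M.eRk X ≤ q}).ncard + {X : Set α | X ⊆ M.E ∧ M.eRk X = M.eRank}.ncard :=
        Set.ncard_union_le _ _
    _ ≤ _ := by
        unfold midCount
        have := Set.ncard_union_le {A : Set α | A ⊆ M.E ∧ (q : ℕ∞) < M.eRk A ∧ M.eRk A < (p : ℕ∞)}
          {X : Set α | X ⊆ M.E ∧ M.eRk X ≤ q}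
        omega

end Matroid

/-- `Σ_{j ≤ k} C(n, j) ≤ (k + 1) · n^k` for `n ≥ 1`. -/
theorem sum_choose_le (n k : ℕ) (hn : 1 ≤ n) :
    ((∑ j ∈ Finset.range (k + 1), n.choose j : ℕ) : ℝ) ≤ (k + 1) * (n : ℝ) ^ k := by
  have : ∀ j ∈ Finset.range (k + 1), (n.choose j : ℝ) ≤ (n : ℝ) ^ k := by
    intro j hj
    rw [Finset.mem_range] at hj
    calc (n.choose j : ℝ) ≤ ((n ^ j : ℕ) : ℝ) := by exact_mod_cast Nat.choose_le_pow n j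
      _ = (n : ℝ) ^ j := by push_cast; rfl
      _ ≤ (n : ℝ) ^ k := pow_le_pow_right₀ (by exact_mod_cast hn) (by omega)
  calc ((∑ j ∈ Finset.range (k + 1), n.choose j : ℕ) : ℝ) = ∑ j ∈ Finset.range (k + 1), (n.choose j : ℝ) := by
        push_cast; rfl
    _ ≤ ∑ j ∈ Finset.range (k + 1), (n : ℝ) ^ k := Finset.sum_le_sum this
    _ = (k + 1) * (n : ℝ) ^ k := by rw [Finset.sum_const, Finset.card_range]; ring

/-- The real-number core of Theorem C: from the four count bounds and `seqF n < 1`, the inequality. All quantities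
are reals; `n = p + d`, `q + 2 ≤ p`, `2d + 1 ≤ n`. -/
theorem theoremC_arith {n p q d K : ℕ} {Φ U Y A B : ℝ} (hq : 2 ≤ q) (hnpd : n = p + d) (hn2 : 2 * d + 1 ≤ n)
    (hΦ : Φ ≤ (2 : ℝ) ^ (p + q) / ((p + q).choose p : ℝ)) (hU0 : 0 ≤ U)
    (hU : U ≤ (n.choose q : ℝ) + (K : ℝ) * ((∑ j ∈ Finset.range (q - 2 + 1), n.choose j : ℕ) : ℝ))
    (hY : (2 : ℝ) ^ n ≤ Y + A + B)
    (hA : A ≤ ((∑ j ∈ Finset.range (q + d + 1), n.choose j : ℕ) : ℝ))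
    (hB : B ≤ ((∑ j ∈ Finset.range (d + 1), n.choose j : ℕ) : ℝ))
    (hF : seqF q d ((K : ℝ) * ((q : ℝ) - 1) * (q.factorial : ℝ) * 2 ^ (q - 2)) (2 * ((q : ℝ) + d + 1)) n < 1) :
    Φ * U ≤ Y := by
  have hn1 : (1 : ℝ) ≤ n := by exact_mod_cast (show 1 ≤ n by omega)
  have hd1n : (d : ℝ) + 1 ≤ n := by exact_mod_cast (show d + 1 ≤ n by omega)
  have hnd : (0 : ℝ) < (n : ℝ) - d := by linarith
  have hnd1 : (1 : ℝ) ≤ (n : ℝ) - d := by linarith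
  have h2dn : (2 * d : ℝ) ≤ n := by exact_mod_cast (show 2 * d ≤ n by omega)
  have hratio : (n : ℝ) / ((n : ℝ) - d) ≤ 2 := by
    rw [div_le_iff₀ hnd]; linarith
  have hnr : (n : ℝ) = p + d := by exact_mod_cast hnpd
  have hp1 : (p : ℝ) + 1 = (n : ℝ) - d + 1 := by linarith
  have hqf : (0 : ℝ) < (q.factorial : ℝ) := by exact_mod_cast Nat.factorial_pos q
  have hq1 : (1 : ℝ) ≤ q := by exact_mod_cast (show 1 ≤ q by omega)
  -- (1) Φ ≤ 2^{p+q} q! / (n − d + 1)^q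
  have hchoose_lower : ((n : ℝ) - d + 1) ^ q / (q.factorial : ℝ) ≤ ((p + q).choose p : ℝ) := by
    have h := Nat.pow_le_choose (α := ℝ) q (p + q)
    have hsub : p + q + 1 - q = p + 1 := by omega
    rw [hsub, ← Nat.choose_symm_add] at h
    have hc : (((p + 1 : ℕ) : ℝ)) ^ q = ((n : ℝ) - d + 1) ^ q := by
      rw [← hp1]; push_cast; ring
    rw [hc] at h
    exact h
  have hpow_pos : (0 : ℝ) < ((n : ℝ) - d + 1) ^ q := by positivity
  have hΦ' : Φ ≤ (2 : ℝ) ^ (p + q) * (q.factorial : ℝ) / ((n : ℝ) - d + 1) ^ q := by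
    calc Φ ≤ (2 : ℝ) ^ (p + q) / ((p + q).choose p : ℝ) := hΦ
      _ ≤ (2 : ℝ) ^ (p + q) / (((n : ℝ) - d + 1) ^ q / (q.factorial : ℝ)) :=
          div_le_div_of_nonneg_left (by positivity) (by positivity) hchoose_lower
      _ = (2 : ℝ) ^ (p + q) * (q.factorial : ℝ) / ((n : ℝ) - d + 1) ^ q := by
          rw [div_div_eq_mul_div]
  -- (2) U ≤ n^q/q! + K (q−1) n^{q−2}
  have hS : ((∑ j ∈ Finset.range (q - 2 + 1), n.choose j : ℕ) : ℝ) ≤ (((q - 2 : ℕ) : ℝ) + 1) * (n : ℝ) ^ (q - 2) :=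
    sum_choose_le n (q - 2) (by omega)
  have hq2c : ((q - 2 : ℕ) : ℝ) + 1 = (q : ℝ) - 1 := by
    have : ((q - 2 : ℕ) : ℝ) + 2 = q := by exact_mod_cast (show (q - 2) + 2 = q by omega)
    linarith
  have hC : (n.choose q : ℝ) ≤ (n : ℝ) ^ q / (q.factorial : ℝ) := Nat.choose_le_pow_div q n
  have hK0 : (0 : ℝ) ≤ (K : ℝ) := by positivity
  have hU' : U ≤ (n : ℝ) ^ q / (q.factorial : ℝ) + (K : ℝ) * (((q : ℝ) - 1) * (n : ℝ) ^ (q - 2)) := by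
    rw [hq2c] at hS
    calc U ≤ (n.choose q : ℝ) + (K : ℝ) * ((∑ j ∈ Finset.range (q - 2 + 1), n.choose j : ℕ) : ℝ) := hU
      _ ≤ (n : ℝ) ^ q / (q.factorial : ℝ) + (K : ℝ) * (((q : ℝ) - 1) * (n : ℝ) ^ (q - 2)) :=
          add_le_add hC (mul_le_mul_of_nonneg_left hS hK0)
  -- (3) the product bound
  have hprod : Φ * U ≤ (2 : ℝ) ^ (p + q) *
      (((n : ℝ) / ((n : ℝ) - d + 1)) ^ q +
        ((K : ℝ) * ((q : ℝ) - 1) * (q.factorial : ℝ)) * ((n : ℝ) ^ (q - 2) / ((n : ℝ) - d + 1) ^ q)) := by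
    have hΦ0' : 0 ≤ (2 : ℝ) ^ (p + q) * (q.factorial : ℝ) / ((n : ℝ) - d + 1) ^ q := by positivity
    calc Φ * U ≤ ((2 : ℝ) ^ (p + q) * (q.factorial : ℝ) / ((n : ℝ) - d + 1) ^ q) *
          ((n : ℝ) ^ q / (q.factorial : ℝ) + (K : ℝ) * (((q : ℝ) - 1) * (n : ℝ) ^ (q - 2))) :=
          mul_le_mul hΦ' hU' hU0 hΦ0'
      _ = (2 : ℝ) ^ (p + q) *
          (((n : ℝ) / ((n : ℝ) - d + 1)) ^ q +
            ((K : ℝ) * ((q : ℝ) - 1) * (q.factorial : ℝ)) * ((n : ℝ) ^ (q - 2) / ((n : ℝ) - d + 1) ^ q)) := by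
          rw [div_pow]
          field_simp
  -- (4) shrink the denominators
  have hnd1' : (n : ℝ) - d ≤ (n : ℝ) - d + 1 := by linarith
  have h1 : ((n : ℝ) / ((n : ℝ) - d + 1)) ^ q ≤ ((n : ℝ) / ((n : ℝ) - d)) ^ q := by
    apply pow_le_pow_left₀ (by positivity)
    exact div_le_div_of_nonneg_left (by positivity) hnd hnd1'
  have h2 : (n : ℝ) ^ (q - 2) / ((n : ℝ) - d + 1) ^ q ≤ 2 ^ (q - 2) / ((n : ℝ) - d) := by
    have hstep1 : (n : ℝ) ^ (q - 2) / ((n : ℝ) - d + 1) ^ q ≤ (n : ℝ) ^ (q - 2) / ((n : ℝ) - d) ^ q :=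
      div_le_div_of_nonneg_left (by positivity) (by positivity) (pow_le_pow_left₀ hnd.le hnd1' q)
    have hstep2 : (n : ℝ) ^ (q - 2) / ((n : ℝ) - d) ^ q =
        ((n : ℝ) / ((n : ℝ) - d)) ^ (q - 2) / ((n : ℝ) - d) ^ 2 := by
      have hsplit : ((n : ℝ) - d) ^ q = ((n : ℝ) - d) ^ (q - 2) * ((n : ℝ) - d) ^ 2 := by
        rw [← pow_add]; congr 1; omega
      rw [hsplit, div_pow]
      field_simp
    have hstep3 : ((n : ℝ) / ((n : ℝ) - d)) ^ (q - 2) / ((n : ℝ) - d) ^ 2 ≤ 2 ^ (q - 2) / ((n : ℝ) - d) ^ 2 := by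
      apply div_le_div_of_nonneg_right _ (by positivity)
      exact pow_le_pow_left₀ (by positivity) hratio _
    have hstep4 : (2 : ℝ) ^ (q - 2) / ((n : ℝ) - d) ^ 2 ≤ 2 ^ (q - 2) / ((n : ℝ) - d) := by
      apply div_le_div_of_nonneg_left (by positivity) hnd
      calc (n : ℝ) - d = ((n : ℝ) - d) * 1 := by ring
        _ ≤ ((n : ℝ) - d) * ((n : ℝ) - d) := mul_le_mul_of_nonneg_left hnd1 hnd.le
        _ = ((n : ℝ) - d) ^ 2 := by ring
    calc (n : ℝ) ^ (q - 2) / ((n : ℝ) - d + 1) ^ q ≤ (n : ℝ) ^ (q - 2) / ((n : ℝ) - d) ^ q := hstep1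
      _ = ((n : ℝ) / ((n : ℝ) - d)) ^ (q - 2) / ((n : ℝ) - d) ^ 2 := hstep2
      _ ≤ 2 ^ (q - 2) / ((n : ℝ) - d) ^ 2 := hstep3
      _ ≤ 2 ^ (q - 2) / ((n : ℝ) - d) := hstep4
  have hKq0 : (0 : ℝ) ≤ (K : ℝ) * ((q : ℝ) - 1) * (q.factorial : ℝ) := by
    have : (0 : ℝ) ≤ (q : ℝ) - 1 := by linarith
    positivity
  have hprod' : Φ * U ≤ (2 : ℝ) ^ (p + q) *
      (((n : ℝ) / ((n : ℝ) - d)) ^ q +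
        ((K : ℝ) * ((q : ℝ) - 1) * (q.factorial : ℝ) * 2 ^ (q - 2)) / ((n : ℝ) - d)) := by
    refine hprod.trans (mul_le_mul_of_nonneg_left ?_ (by positivity))
    refine add_le_add h1 ?_
    calc ((K : ℝ) * ((q : ℝ) - 1) * (q.factorial : ℝ)) * ((n : ℝ) ^ (q - 2) / ((n : ℝ) - d + 1) ^ q)
        ≤ ((K : ℝ) * ((q : ℝ) - 1) * (q.factorial : ℝ)) * (2 ^ (q - 2) / ((n : ℝ) - d)) :=
          mul_le_mul_of_nonneg_left h2 hKq0
      _ = ((K : ℝ) * ((q : ℝ) - 1) * (q.factorial : ℝ) * 2 ^ (q - 2)) / ((n : ℝ) - d) := by ring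
  -- (5) 2^{p+q} = 2^n · 2^q / 2^d
  have hpow : (2 : ℝ) ^ (p + q) = 2 ^ n * (2 ^ q / 2 ^ d) := by
    have hsum : n + q = (p + q) + d := by omega
    have h2d : (0 : ℝ) < 2 ^ d := by positivity
    rw [eq_comm, mul_div_assoc', div_eq_iff h2d.ne', ← pow_add, ← pow_add, hsum]
  -- (6) A + B ≤ 2 (q + d + 1) n^{q+d}
  have hAB : A + B ≤ 2 * ((q : ℝ) + d + 1) * (n : ℝ) ^ (q + d) := by
    have hA' := hA.trans (sum_choose_le n (q + d) (by omega))
    have hB' := hB.trans (sum_choose_le n d (by omega))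
    have hmono : (n : ℝ) ^ d ≤ (n : ℝ) ^ (q + d) := pow_le_pow_right₀ hn1 (by omega)
    have hpos : (0 : ℝ) ≤ (n : ℝ) ^ d := by positivity
    have hcastA : (((q + d : ℕ) : ℝ) + 1) = (q : ℝ) + d + 1 := by push_cast; ring
    rw [hcastA] at hA'
    have hB'' : B ≤ ((q : ℝ) + d + 1) * (n : ℝ) ^ (q + d) := by
      calc B ≤ ((d : ℝ) + 1) * (n : ℝ) ^ d := hB'
        _ ≤ ((q : ℝ) + d + 1) * (n : ℝ) ^ (q + d) :=
            mul_le_mul (by linarith) hmono hpos (by positivity)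
    linarith
  -- (7) combine with `seqF n < 1`
  have h2n : (0 : ℝ) < 2 ^ n := by positivity
  have hseq : seqF q d ((K : ℝ) * ((q : ℝ) - 1) * (q.factorial : ℝ) * 2 ^ (q - 2)) (2 * ((q : ℝ) + d + 1)) n =
      (2 : ℝ) ^ q / 2 ^ d * ((((n : ℝ) / ((n : ℝ) - d)) ^ q +
        ((K : ℝ) * ((q : ℝ) - 1) * (q.factorial : ℝ) * 2 ^ (q - 2)) / ((n : ℝ) - d))) +
        2 * ((q : ℝ) + d + 1) * ((n : ℝ) ^ (q + d) / 2 ^ n) := by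
    unfold seqF
    ring
  rw [hseq] at hF
  have hAB' : A + B ≤ 2 ^ n * (2 * ((q : ℝ) + d + 1) * ((n : ℝ) ^ (q + d) / 2 ^ n)) := by
    have : (2 : ℝ) ^ n * (2 * ((q : ℝ) + d + 1) * ((n : ℝ) ^ (q + d) / 2 ^ n)) =
        2 * ((q : ℝ) + d + 1) * (n : ℝ) ^ (q + d) := by
      field_simp
    rw [this]
    exact hAB
  have hΦU : Φ * U ≤ 2 ^ n * ((2 : ℝ) ^ q / 2 ^ d * ((((n : ℝ) / ((n : ℝ) - d)) ^ q +
        ((K : ℝ) * ((q : ℝ) - 1) * (q.factorial : ℝ) * 2 ^ (q - 2)) / ((n : ℝ) - d)))) := by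
    rw [← mul_assoc, ← hpow]
    exact hprod'
  have hmain : Φ * U + (A + B) < 2 ^ n := by
    have hlt : 2 ^ n * ((2 : ℝ) ^ q / 2 ^ d * ((((n : ℝ) / ((n : ℝ) - d)) ^ q +
        ((K : ℝ) * ((q : ℝ) - 1) * (q.factorial : ℝ) * 2 ^ (q - 2)) / ((n : ℝ) - d))) +
        2 * ((q : ℝ) + d + 1) * ((n : ℝ) ^ (q + d) / 2 ^ n)) < 2 ^ n * 1 :=
      mul_lt_mul_of_pos_left hF h2n
    rw [mul_one, mul_add] at hlt
    linarith
  linarith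

/-- **THEOREM C (kernel form)**: for every `q ≥ 2` and corank `d ≥ q + 1` there is `N₀` such that every simple finite
matroid (every circuit has `≥ 3` elements) of rank `p` with `|E| = p + d`, `|E| ≥ N₀` and `q + 2 ≤ p` satisfies the
`C025` body `Φ(p,q)·#U(p,q) ≤ #Y(p,q)`. -/
theorem exists_N₀_c025_simple (q d : ℕ) (hq : 2 ≤ q) (hqd : q + 1 ≤ d) :
    ∃ N₀ : ℕ, ∀ {α : Type} (M : _root_.Matroid α) [M.Finite] (p : ℕ),
      N₀ ≤ M.E.ncard → M.E.encard = M.eRank + d → M.eRank = (p : ℕ∞) → q + 2 ≤ p →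
      (∀ C, M.IsCircuit C → 3 ≤ C.encard) →
      phiK p q * (Matroid.topCount M p q : ℚ) ≤ (Matroid.midCount M p q : ℚ) := by
  classical
  set K : ℕ := 2 ^ ((q + 1) * d) * 2 ^ (q + d) with hK
  obtain ⟨N₀, hN₀⟩ := exists_bound_seqF q d hqd
    ((K : ℝ) * ((q : ℝ) - 1) * (q.factorial : ℝ) * 2 ^ (q - 2)) (2 * ((q : ℝ) + d + 1))
  refine ⟨max N₀ (2 * d + 1), ?_⟩
  intro α M _ p hn hd hR hpq hcirc
  set n := M.E.ncard with hn_def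
  have hn1 : N₀ ≤ n := le_trans (le_max_left _ _) hn
  have hn2 : 2 * d + 1 ≤ n := le_trans (le_max_right _ _) hn
  have hEcard : M.ground_finite.toFinset.card = n := by
    rw [hn_def, Set.ncard_eq_toFinset_card _ M.ground_finite]
  have hnpd : n = p + d := by
    have h := hd
    rw [← M.ground_finite.cast_ncard_eq, hR] at h
    exact_mod_cast h
  -- (U): #U ≤ C(n,q) + K · Σ_{j ≤ q−2} C(n,j)
  have hU : Matroid.topCount M p q ≤ n.choose q + K * ∑ j ∈ Finset.range (q - 2 + 1), n.choose j := by
    have h1 := Matroid.ncard_eRk_eq_le (M := M) hcirc (q := q) hd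
    have h2 := Matroid.ncard_circuitsLE_le (M := M) (k := q + 1) hd
    rw [hEcard] at h1
    calc Matroid.topCount M p q ≤ Matroid.levelCount M q := Matroid.topCount_le_levelCount_bot p q
      _ = {X : Set α | X ⊆ M.E ∧ M.eRk X = q}.ncard := rfl
      _ ≤ n.choose q + (Matroid.circuitsLE M (q + 1)).ncard *
            (∑ j ∈ Finset.range (q - 2 + 1), n.choose j) * 2 ^ (q + d) := h1
      _ ≤ n.choose q + 2 ^ ((q + 1) * d) * (∑ j ∈ Finset.range (q - 2 + 1), n.choose j) * 2 ^ (q + d) := by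
          gcongr
      _ = n.choose q + K * ∑ j ∈ Finset.range (q - 2 + 1), n.choose j := by rw [hK]; ring
  -- (Y): 2^n ≤ #Y + A + B
  have hY : 2 ^ n ≤ Matroid.midCount M p q + (∑ j ∈ Finset.range (q + d + 1), n.choose j) +
      (∑ j ∈ Finset.range (d + 1), n.choose j) := by
    have h := Matroid.two_pow_le_midCount_add (M := M) p q hR
    have hA := Matroid.ncard_eRk_le_le (M := M) (q := q) hd
    have hB := Matroid.ncard_spanning_le (M := M) hd
    rw [hEcard] at h hA hB
    omega
  -- (Φ)
  have hΦ := phiK_le_two_pow_div p q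
  -- to the reals
  have hΦr : ((phiK p q : ℚ) : ℝ) ≤ (2 : ℝ) ^ (p + q) / ((p + q).choose p : ℝ) := by
    have := hΦ
    have h' : ((phiK p q : ℚ) : ℝ) ≤ (((2 ^ (p + q) : ℚ) / ((p + q).choose p : ℚ) : ℚ) : ℝ) := by
      exact_mod_cast this
    push_cast at h'
    exact h'
  have hUr : (Matroid.topCount M p q : ℝ) ≤ (n.choose q : ℝ) +
      (K : ℝ) * ((∑ j ∈ Finset.range (q - 2 + 1), n.choose j : ℕ) : ℝ) := by
    have := hU
    exact_mod_cast this
  have hYr : (2 : ℝ) ^ n ≤ (Matroid.midCount M p q : ℝ) + ((∑ j ∈ Finset.range (q + d + 1), n.choose j : ℕ) : ℝ) +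
      ((∑ j ∈ Finset.range (d + 1), n.choose j : ℕ) : ℝ) := by
    have := hY
    exact_mod_cast this
  have hmain : ((phiK p q : ℚ) : ℝ) * (Matroid.topCount M p q : ℝ) ≤ (Matroid.midCount M p q : ℝ) :=
    theoremC_arith hq hnpd hn2 hΦr (by positivity) hUr hYr le_rfl le_rfl (hN₀ n hn1)
  exact_mod_cast hmain

end PercRepro
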